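import Mathlib
import HarnessLib
import Summits.HubbardSuperconductivity.HubbardSuperconductivity.Theorems.KLProgrammeC4aPPKernelFamily

/-!
# Route `KLProgramme` — crux C4a, S3 brick (B4) «(B4)-UMK1», «(M1)-FAMILY» part 11: THE THREE-PIECE PARTITION of the true pp kernel — far piece `A`,
# mirror far piece `A′` (= `A` after the zone-box swap), and the COMPARABLE-LEVELS piece `M`

Cell `gate-hubbard-kl`, seat hubbard-kl-k3c3-p1 (g16; row «δμ-flow with klAngularMean constant piece»), located point «(U1)-PARTITION-CLOSURE» (KL STATUS ≈05:00Z,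
pen (R362)).  With `A(e,u) := ppFamilyKernel β Λ κ lo e u = P(e,u)·κ(m_e/(m_e+|u|))` (`m_x = max(|x|,lo)`), the near-caustic laws (parts 8–10) consume `A`; by the
symmetry **`ppTrueKernel_symm`** (`P(e,u) = P(u,e)`) the mirror piece `A′(e,u) := P(e,u)·κ(m_u/(m_u+|e|))` is **`ppFamilyKernel β Λ κ lo u e`** (`ppFamilyKernel_swap`), i.e.
`A` with the lines' roles exchanged; the remainder is the symmetric comparable-levels piece **`ppMiddleKernel β Λ κ lo e u := P(e,u)·(1 − κ(m_e/(m_e+|u|)) − κ(m_u/(m_u+|e|)))`**: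
**`ppTrueKernel_eq_family_add_swap_add_middle`** (`P = A + A′ + M`), **`ppMiddleKernel_symm`**, the support **`ppMiddleKernel_eq_zero_of_le_abs_right/left`** (`M = 0`
as soon as one line is `≥ (2−t₁)/t₁` times coarser than the other's scale, for profiles with `κ = 1` on `[0,t₁/2]`, `κ = 0` on `[t₁,∞)`, `t₁ ≤ 2/3` — e.g.
`ppSplitProfile t₁`), and the envelope **`abs_ppMiddleKernel_le`** (`|M| ≤ (1+2κ₀)|P|`).  Which law consumes `M` is the open question (q1) routed to k3c3-p3.
Pure real analysis on Literature objects; nothing asserts (C), K3, the window or superconductivity.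
References: BGM 2006 §2.4 (2.36) [cite: BenfattoGiulianiMastropietro2006]; FST II CPAM 51 (1998) §3 [cite: FeldmanSalmhoferTrubowitz1998].
-/

noncomputable section

namespace Summit.HubbardSuperconductivity.HubbardSuperconductivity.Theorems.C4a

set_option linter.dupNamespace false -- summit = problem name (single-conjunct summit), D-0017

open Real Filter Set
open scoped Topology
open Literature.MathematicalPhysics.QuantumLattice Literature.Analysis.SpecialFunctions

/-! ## §1 Symmetry of `P` and the swap identity -/

/-- **`P(e,u) = P(u,e)`**: the product form is symmetric summand by summand. [cite: BenfattoGiulianiMastropietro2006, §2.4 (2.36)] -/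
theorem ppTrueKernel_symm (β Λ e u : ℝ) : ppTrueKernel β Λ e u = ppTrueKernel β Λ u e := by
  unfold ppTrueKernel
  congr 1
  refine tsum_congr fun n => ?_
  ring

/-- **The mirror far piece is the family with the lines exchanged**: `ppFamilyKernel β Λ κ lo u e = P(e,u)·κ(m_u/(m_u+|e|))`. [folklore] -/
theorem ppFamilyKernel_swap (β Λ : ℝ) (κ : ℝ → ℝ) (lo e u : ℝ) :
    ppFamilyKernel β Λ κ lo u e = ppTrueKernel β Λ e u * κ (familyScale lo u / (familyScale lo u + |e|)) := by
  unfold ppFamilyKernel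
  rw [ppTrueKernel_symm]

/-! ## §2 The comparable-levels piece -/

/-- **The comparable-levels piece** `M(e,u) := P(e,u)·(1 − κ(m_e/(m_e+|u|)) − κ(m_u/(m_u+|e|)))`, `m_x = max(|x|,lo)`: what is left of the true pp kernel after
the far piece `A = ppFamilyKernel … e u` and its mirror `A′ = ppFamilyKernel … u e`. -/
def ppMiddleKernel (β Λ : ℝ) (κ : ℝ → ℝ) (lo e u : ℝ) : ℝ :=
  ppTrueKernel β Λ e u * (1 - κ (familyScale lo e / (familyScale lo e + |u|)) - κ (familyScale lo u / (familyScale lo u + |e|)))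

/-- **`P = A + A′ + M`.** [folklore] -/
theorem ppTrueKernel_eq_family_add_swap_add_middle (β Λ : ℝ) (κ : ℝ → ℝ) (lo e u : ℝ) :
    ppTrueKernel β Λ e u = ppFamilyKernel β Λ κ lo e u + ppFamilyKernel β Λ κ lo u e + ppMiddleKernel β Λ κ lo e u := by
  unfold ppFamilyKernel ppMiddleKernel
  rw [ppTrueKernel_symm β Λ u e]
  ring

/-- **`M` is symmetric**: `M(e,u) = M(u,e)`. [folklore] -/
theorem ppMiddleKernel_symm (β Λ : ℝ) (κ : ℝ → ℝ) (lo e u : ℝ) : ppMiddleKernel β Λ κ lo e u = ppMiddleKernel β Λ κ lo u e := by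
  unfold ppMiddleKernel
  rw [ppTrueKernel_symm]
  ring

/-- The split ratio `m_x/(m_x+|y|)` lies in `(0,1]` (`0 < lo`). [folklore] -/
theorem familyRatio_mem_Ioc {lo : ℝ} (hlo : 0 < lo) (x y : ℝ) : familyScale lo x / (familyScale lo x + |y|) ∈ Ioc (0 : ℝ) 1 := by
  have hm := (familyScale_pos hlo x).1
  have hy := abs_nonneg y
  exact ⟨div_pos hm (by positivity), (div_le_one (by positivity)).2 (by linarith)⟩

/-- **Support of `M`, right form**: if the partner is far coarser, `((2−t₁)/t₁)·m_e ≤ |u|`, then `κ(m_e/(m_e+|u|)) = 1` and `κ(m_u/(m_u+|e|)) = 0`, so `M(e,u) = 0`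
(profile with `κ = 1` on `[0,t₁/2]`, `κ = 0` on `[t₁,∞)`, `0 < t₁ ≤ 2/3`). [folklore] -/
theorem ppMiddleKernel_eq_zero_of_le_abs_right {β Λ : ℝ} {κ : ℝ → ℝ} {t₁ lo e u : ℝ} (hlo : 0 < lo) (ht₀ : 0 < t₁) (ht : t₁ ≤ 2 / 3)
    (hκs : ∀ t, t₁ ≤ t → κ t = 0) (hκ1 : ∀ t, t ≤ t₁ / 2 → κ t = 1) (hu : (2 - t₁) / t₁ * familyScale lo e ≤ |u|) :
    ppMiddleKernel β Λ κ lo e u = 0 := by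
  obtain ⟨hme, hele, -⟩ := familyScale_pos hlo e
  obtain ⟨hmu, huu, -⟩ := familyScale_pos hlo u
  have hq : 0 < (2 - t₁) / t₁ := div_pos (by linarith) ht₀
  -- `κ(m_e/(m_e+|u|)) = 1`
  have h1 : κ (familyScale lo e / (familyScale lo e + |u|)) = 1 := by
    refine hκ1 _ ?_
    rw [div_le_iff₀ (by positivity)]
    have : (2 - t₁) * familyScale lo e ≤ t₁ * |u| := by
      have := mul_le_mul_of_nonneg_left hu ht₀.le
      rwa [← mul_assoc, mul_div_cancel₀ _ ht₀.ne'] at this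
    nlinarith
  -- `κ(m_u/(m_u+|e|)) = 0`
  have h2 : κ (familyScale lo u / (familyScale lo u + |e|)) = 0 := by
    refine hκs _ ?_
    rw [le_div_iff₀ (by positivity)]
    -- `|e| ≤ m_e ≤ (t₁/(2−t₁))·|u| ≤ (t₁/(2−t₁))·m_u`, and `t₁·(m_u + |e|) ≤ m_u` iff `t₁|e| ≤ (1−t₁)m_u`
    have h3 : (2 - t₁) * |e| ≤ t₁ * familyScale lo u := by
      have := mul_le_mul_of_nonneg_left hu ht₀.le
      rw [← mul_assoc, mul_div_cancel₀ _ ht₀.ne'] at this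
      nlinarith
    nlinarith
  unfold ppMiddleKernel
  rw [h1, h2]; ring

/-- **Support of `M`, left form** (by symmetry): `((2−t₁)/t₁)·m_u ≤ |e| ⟹ M(e,u) = 0`. [folklore] -/
theorem ppMiddleKernel_eq_zero_of_le_abs_left {β Λ : ℝ} {κ : ℝ → ℝ} {t₁ lo e u : ℝ} (hlo : 0 < lo) (ht₀ : 0 < t₁) (ht : t₁ ≤ 2 / 3)
    (hκs : ∀ t, t₁ ≤ t → κ t = 0) (hκ1 : ∀ t, t ≤ t₁ / 2 → κ t = 1) (he : (2 - t₁) / t₁ * familyScale lo u ≤ |e|) :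
    ppMiddleKernel β Λ κ lo e u = 0 := by
  rw [ppMiddleKernel_symm]
  exact ppMiddleKernel_eq_zero_of_le_abs_right hlo ht₀ ht hκs hκ1 he

/-- **Envelope of `M`**: `|M(e,u)| ≤ (1 + 2κ₀)·|P(e,u)|` for `|κ| ≤ κ₀` on `[0,1]`. [folklore] -/
theorem abs_ppMiddleKernel_le {β Λ : ℝ} {κ : ℝ → ℝ} {κ₀ lo : ℝ} (hlo : 0 < lo) (hκb : ∀ t ∈ Icc (0 : ℝ) 1, |κ t| ≤ κ₀) (e u : ℝ) :
    |ppMiddleKernel β Λ κ lo e u| ≤ (1 + 2 * κ₀) * |ppTrueKernel β Λ e u| := by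
  have hr1 := familyRatio_mem_Ioc hlo e u
  have hr2 := familyRatio_mem_Ioc hlo u e
  have hk1 := hκb _ ⟨hr1.1.le, hr1.2⟩
  have hk2 := hκb _ ⟨hr2.1.le, hr2.2⟩
  unfold ppMiddleKernel
  rw [abs_mul, mul_comm]
  refine mul_le_mul_of_nonneg_right ?_ (abs_nonneg _)
  have h3 := abs_sub (1 : ℝ) (κ (familyScale lo e / (familyScale lo e + |u|)))
  rw [abs_one] at h3
  calc |1 - κ (familyScale lo e / (familyScale lo e + |u|)) - κ (familyScale lo u / (familyScale lo u + |e|))|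
      ≤ |1 - κ (familyScale lo e / (familyScale lo e + |u|))| + |κ (familyScale lo u / (familyScale lo u + |e|))| := abs_sub _ _
    _ ≤ 1 + 2 * κ₀ := by linarith

/-- **Envelope of `M` in the scale**: `|M(e,u)| ≤ (1+2κ₀)(12B₁+9)·(max |e| |u|)⁻¹` for `e ≠ 0`. [cite: BenfattoGiulianiMastropietro2006, §2.4 (2.36)] -/
theorem abs_ppMiddleKernel_le_inv_max {β Λ : ℝ} (hβ : 0 < β) (hΛ : 0 < Λ) {B₁ : ℝ} (hB₁ : ∀ x, |deriv salmhoferCutoff x| ≤ B₁) {κ : ℝ → ℝ} {κ₀ lo : ℝ}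
    (hlo : 0 < lo) (hκb : ∀ t ∈ Icc (0 : ℝ) 1, |κ t| ≤ κ₀) {e : ℝ} (he : e ≠ 0) (u : ℝ) :
    |ppMiddleKernel β Λ κ lo e u| ≤ (1 + 2 * κ₀) * (12 * B₁ + 9) * (max |e| |u|)⁻¹ := by
  have hκ₀ : 0 ≤ κ₀ := (abs_nonneg _).trans (hκb 0 (left_mem_Icc.2 zero_le_one))
  rw [mul_assoc]
  exact (abs_ppMiddleKernel_le hlo hκb e u).trans (mul_le_mul_of_nonneg_left (abs_ppTrueKernel_le_inv_max_abs hβ hΛ hB₁ he u) (by positivity))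

/-- **Envelope of `M` on all levels**: `|M(e,u)| ≤ (1+2κ₀)·4/Λ`. [cite: BenfattoGiulianiMastropietro2006, §2.4 (2.36)] -/
theorem abs_ppMiddleKernel_le_four_div {β Λ : ℝ} (hβ : 0 < β) (hΛ : 0 < Λ) {κ : ℝ → ℝ} {κ₀ lo : ℝ} (hlo : 0 < lo) (hκb : ∀ t ∈ Icc (0 : ℝ) 1, |κ t| ≤ κ₀)
    (e u : ℝ) : |ppMiddleKernel β Λ κ lo e u| ≤ (1 + 2 * κ₀) * (4 / Λ) := by
  have hκ₀ : 0 ≤ κ₀ := (abs_nonneg _).trans (hκb 0 (left_mem_Icc.2 zero_le_one))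
  exact (abs_ppMiddleKernel_le hlo hκb e u).trans (mul_le_mul_of_nonneg_left (abs_ppTrueKernel_le_four_div hβ hΛ e u) (by positivity))

end Summit.HubbardSuperconductivity.HubbardSuperconductivity.Theorems.C4a

end
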